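import Mathlib
import Literature.Barriers.AtomisticToContinuum.SpectralGapClosing
import Literature.MathematicalPhysics.KineticTheory.MomentumHermiteLadder
import Summits.AtomisticToContinuum.FouriersLaw.Theses.LatticeLandauDamping
import HarnessLib

/-!
# `LatticeLandauDamping.LoweredCurrent` — the lowered current / pinning criterion, proved

Item `stmt-AtomisticToContinuum-14017` (support, route `LatticeLandauDamping`, sub-problem
`FouriersLaw`). For every chain `P` with `C²` potentials `U, V`, every `N`, `T` and phase point
`x = (q, p)`, the momentum-lowering operator
`R† g = ∑_i (-T ∂_{q_i}∂_{p_i} g + ∂_{q_i}H ∂_{p_i} g)` (`OscillatorChain.momentumLowering`) applied to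
the total current `J = ∑_b j_b`, `j_b = -½ (p_b + p_{b+1}) V'(q_{b+1} - q_b)` (free ends,
`OscillatorChain.bondCurrent`), is

  `R† J = -½ ∑_i U'(q_i) (V'(q_{i+1} - q_i)·[i+1 < N] + V'(q_i - q_{i-1})·[0 < i])`,

so `R† J ≡ 0` iff the chain is unpinned. Proof (pointwise calculus, no measure theory). Write
`R_i = V'(q_{i+1} - q_i)·[i+1 < N]` (`rightTerm`) and `L_i = V'(q_i - q_{i-1})·[0 < i]` (`leftTerm`,
both from `Literature.Barriers.AtomisticToContinuum.SpectralGapClosing`).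

* `sum_bondCurrent_eq` — `J = ∑_i p_i c_i(q)` with `c_i = -½ (R_i + L_i)`, hence
  `partialP_sum_bondCurrent`: `∂_{p_i} J = c_i(q)` (`partialP_sum_snd_mul`).
* `hasDerivAt_rightTerm_update`, `hasDerivAt_leftTerm_update` — `∂_{q_i} R_i = -R'_i`,
  `∂_{q_i} L_i = L'_i` (primes: one more derivative of `V`), so
  `partialQ_partialP_sum_bondCurrent`: `∂_{q_i}∂_{p_i} J = -½ (L'_i - R'_i)`, and the `T`-term
  `(T/2) ∑_i (L'_i - R'_i)` telescopes to `0` (`sum_leftTerm_eq_sum_rightTerm`, a `Finset.sum_comm`).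
* `∂_{q_i} H = U'(q_i) + L_i - R_i` (`Literature.Barriers.AtomisticToContinuum.partialQ_hamiltonian`),
  and `∑_i (L_i - R_i)(R_i + L_i) = ∑_i L_i² - ∑_i R_i² = 0` by the same telescoping.

No definitions; everything is proved.
-/

noncomputable section

namespace Summit.AtomisticToContinuum.FouriersLaw.Theorems.LoweredCurrent

open Literature.MathematicalPhysics.KineticTheory.HeatConduction
open Literature.MathematicalPhysics.KineticTheory
open Literature.Barriers.AtomisticToContinuum

variable {N : ℕ}

/-- **Telescoping over the bonds**: `∑_i g(q_i - q_{i-1})·[0 < i] = ∑_i g(q_{i+1} - q_i)·[i+1 < N]`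
(both sides are the sum of `g` over the `N - 1` bonds of the free-end chain). [folklore] -/
theorem sum_leftTerm_eq_sum_rightTerm (g : ℝ → ℝ) (q : Fin N → ℝ) :
    ∑ i, leftTerm g q i = ∑ i, rightTerm g q i := by
  simp_rw [← sum_ite_eq_leftTerm, ← sum_ite_eq_rightTerm]
  exact Finset.sum_comm

/-- `leftTerm` is multiplicative in the bond function. [folklore] -/
theorem leftTerm_mul_leftTerm (g₁ g₂ : ℝ → ℝ) (q : Fin N → ℝ) (i : Fin N) :
    leftTerm g₁ q i * leftTerm g₂ q i = leftTerm (fun r => g₁ r * g₂ r) q i := by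
  unfold leftTerm
  split_ifs <;> simp

/-- `rightTerm` is multiplicative in the bond function. [folklore] -/
theorem rightTerm_mul_rightTerm (g₁ g₂ : ℝ → ℝ) (q : Fin N → ℝ) (i : Fin N) :
    rightTerm g₁ q i * rightTerm g₂ q i = rightTerm (fun r => g₁ r * g₂ r) q i := by
  unfold rightTerm
  split_ifs <;> simp

/-- `∂_{q_i}` of the right bond term: `d/dt g(q_{i+1} - t)|_{t = q_i} = -g'(q_{i+1} - q_i)` (and `0`
at the right end of the chain). [folklore] -/
theorem hasDerivAt_rightTerm_update {g : ℝ → ℝ} (hg : Differentiable ℝ g) (q : Fin N → ℝ)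
    (i : Fin N) :
    HasDerivAt (fun t => rightTerm g (Function.update q i t) i) (-rightTerm (deriv g) q i)
      (q i) := by
  unfold rightTerm
  by_cases h : i.val + 1 < N
  · have hne : (⟨i.val + 1, h⟩ : Fin N) ≠ i :=
      Fin.ne_of_val_ne (by show i.val + 1 ≠ i.val; omega)
    simp only [dif_pos h, Function.update_self, Function.update_of_ne hne]
    have h1 : HasDerivAt (fun t : ℝ => q ⟨i.val + 1, h⟩ - t) (-1) (q i) :=
      (hasDerivAt_id' (q i)).const_sub _
    have h2 := ((hg _).hasDerivAt).comp (q i) h1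
    rw [mul_neg_one] at h2
    exact h2
  · simp only [dif_neg h, neg_zero]
    exact hasDerivAt_const _ _

/-- `∂_{q_i}` of the left bond term: `d/dt g(t - q_{i-1})|_{t = q_i} = g'(q_i - q_{i-1})` (and `0`
at the left end of the chain). [folklore] -/
theorem hasDerivAt_leftTerm_update {g : ℝ → ℝ} (hg : Differentiable ℝ g) (q : Fin N → ℝ)
    (i : Fin N) :
    HasDerivAt (fun t => leftTerm g (Function.update q i t) i) (leftTerm (deriv g) q i) (q i) := by
  unfold leftTerm
  by_cases h : 0 < i.val
  · have hne : (⟨i.val - 1, by omega⟩ : Fin N) ≠ i :=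
      Fin.ne_of_val_ne (by show i.val - 1 ≠ i.val; omega)
    simp only [dif_pos h, Function.update_self, Function.update_of_ne hne]
    have h1 : HasDerivAt (fun t : ℝ => t - q ⟨i.val - 1, by omega⟩) 1 (q i) :=
      (hasDerivAt_id' (q i)).sub_const _
    have h2 := ((hg _).hasDerivAt).comp (q i) h1
    rw [mul_one] at h2
    exact h2
  · simp only [dif_neg h]
    exact hasDerivAt_const _ _

/-- **The total current is linear in the momenta**: `∑_b j_b = ∑_i p_i c_i(q)` with
`c_i(q) = -½ (V'(q_{i+1} - q_i)·[i+1 < N] + V'(q_i - q_{i-1})·[0 < i])` — each bond current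
`-½ (p_b + p_{b+1}) V'(q_{b+1} - q_b)` contributes its `V'` to the two sites it joins. [folklore] -/
theorem sum_bondCurrent_eq (P : OscillatorChain) (y : PhaseSpace N) :
    ∑ b, P.bondCurrent N b y =
      ∑ i, y.2 i * (-(1 / 2) * (rightTerm (deriv P.V) y.1 i + leftTerm (deriv P.V) y.1 i)) := by
  have hsplit : ∀ b j : Fin N,
      (if j.val = b.val + 1 then -((y.2 b + y.2 j) / 2 * deriv P.V (y.1 j - y.1 b)) else (0 : ℝ)) =
        y.2 b * (if j.val = b.val + 1 then -(1 / 2) * deriv P.V (y.1 j - y.1 b) else 0) +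
          y.2 j * (if j.val = b.val + 1 then -(1 / 2) * deriv P.V (y.1 j - y.1 b) else 0) := by
    intro b j
    split_ifs <;> ring
  have hR : ∀ i : Fin N,
      (∑ j : Fin N, if j.val = i.val + 1 then -(1 / 2) * deriv P.V (y.1 j - y.1 i) else 0) =
        -(1 / 2) * rightTerm (deriv P.V) y.1 i := by
    intro i
    rw [← sum_ite_eq_rightTerm, Finset.mul_sum]
    exact Finset.sum_congr rfl fun j _ => by split_ifs <;> simp
  have hL : ∀ j : Fin N,
      (∑ b : Fin N, if j.val = b.val + 1 then -(1 / 2) * deriv P.V (y.1 j - y.1 b) else 0) =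
        -(1 / 2) * leftTerm (deriv P.V) y.1 j := by
    intro j
    rw [← sum_ite_eq_leftTerm, Finset.mul_sum]
    exact Finset.sum_congr rfl fun b _ => by split_ifs <;> simp
  have h1 : ∑ b : Fin N, ∑ j : Fin N,
      y.2 b * (if j.val = b.val + 1 then -(1 / 2) * deriv P.V (y.1 j - y.1 b) else 0) =
        ∑ i, y.2 i * (-(1 / 2) * rightTerm (deriv P.V) y.1 i) :=
    Finset.sum_congr rfl fun b _ => by rw [← Finset.mul_sum, hR]
  have h2 : ∑ b : Fin N, ∑ j : Fin N,
      y.2 j * (if j.val = b.val + 1 then -(1 / 2) * deriv P.V (y.1 j - y.1 b) else 0) =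
        ∑ i, y.2 i * (-(1 / 2) * leftTerm (deriv P.V) y.1 i) := by
    rw [Finset.sum_comm]
    exact Finset.sum_congr rfl fun j _ => by rw [← Finset.mul_sum, hL]
  simp only [OscillatorChain.bondCurrent]
  simp_rw [hsplit, Finset.sum_add_distrib]
  rw [h1, h2, ← Finset.sum_add_distrib]
  exact Finset.sum_congr rfl fun i _ => by ring

/-- **`∂_{p_i} J = c_i(q)`**: the momentum derivative of the total current is the position
function `-½ (V'(q_{i+1} - q_i)·[i+1 < N] + V'(q_i - q_{i-1})·[0 < i])`. [folklore] -/
theorem partialP_sum_bondCurrent (P : OscillatorChain) (i : Fin N) (x : PhaseSpace N) :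
    partialP i (fun y : PhaseSpace N => ∑ b, P.bondCurrent N b y) x =
      -(1 / 2) * (rightTerm (deriv P.V) x.1 i + leftTerm (deriv P.V) x.1 i) := by
  have hJ : (fun y : PhaseSpace N => ∑ b, P.bondCurrent N b y) = fun y =>
      ∑ i, y.2 i * (-(1 / 2) * (rightTerm (deriv P.V) y.1 i + leftTerm (deriv P.V) y.1 i)) :=
    funext fun y => sum_bondCurrent_eq P y
  rw [hJ]
  exact partialP_sum_snd_mul
    (fun j q => -(1 / 2) * (rightTerm (deriv P.V) q j + leftTerm (deriv P.V) q j)) i x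

/-- **`∂_{q_i} ∂_{p_i} J`**: for `V'` differentiable,
`∂_{q_i}∂_{p_i} J = -½ (-V''(q_{i+1} - q_i)·[i+1 < N] + V''(q_i - q_{i-1})·[0 < i])`. [folklore] -/
theorem partialQ_partialP_sum_bondCurrent (P : OscillatorChain) (hV : Differentiable ℝ (deriv P.V))
    (i : Fin N) (x : PhaseSpace N) :
    partialQ i (partialP i (fun y : PhaseSpace N => ∑ b, P.bondCurrent N b y)) x =
      -(1 / 2) * (-rightTerm (deriv (deriv P.V)) x.1 i + leftTerm (deriv (deriv P.V)) x.1 i) := by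
  have hP : partialP i (fun y : PhaseSpace N => ∑ b, P.bondCurrent N b y) = fun y =>
      -(1 / 2) * (rightTerm (deriv P.V) y.1 i + leftTerm (deriv P.V) y.1 i) :=
    funext fun y => partialP_sum_bondCurrent P i y
  rw [hP]
  unfold partialQ
  exact (((hasDerivAt_rightTerm_update hV x.1 i).add
    (hasDerivAt_leftTerm_update hV x.1 i)).const_mul (-(1 / 2))).deriv

/-- **The lowered current / pinning criterion** (route item `LoweredCurrent`,
`stmt-AtomisticToContinuum-14017`): for every chain `P` with `C²` potentials, every `N`, `T` and
phase point, `R† (∑_b j_b) = -½ ∑_i U'(q_i) (V'(q_{i+1} - q_i)·[i+1 < N] + V'(q_i - q_{i-1})·[0 < i])`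
— the `T ∂_q∂_p`-term and the `V'`-part of `∂_q H` telescope away, so `R† J ≡ 0` iff the chain is
unpinned. [folklore] -/
theorem loweredCurrent_proof :
    Summit.AtomisticToContinuum.FouriersLaw.Theses.LatticeLandauDamping.LoweredCurrent := by
  unfold Summit.AtomisticToContinuum.FouriersLaw.Theses.LatticeLandauDamping.LoweredCurrent
  intro P N T hU hV x
  -- smoothness bookkeeping
  have hUd : Differentiable ℝ P.U := hU.differentiable two_ne_zero
  have hVd : Differentiable ℝ P.V := hV.differentiable two_ne_zero
  have hV1 : ContDiff ℝ 1 (deriv P.V) := hV.deriv'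
  have hV'd : Differentiable ℝ (deriv P.V) := hV1.differentiable one_ne_zero
  -- the right-hand side's inner sums are `R_i + L_i`
  have hRHS : ∀ i : Fin N,
      (∑ j : Fin N, ((if j.val = i.val + 1 then deriv P.V (x.1 j - x.1 i) else 0) +
        (if i.val = j.val + 1 then deriv P.V (x.1 i - x.1 j) else 0))) =
      rightTerm (deriv P.V) x.1 i + leftTerm (deriv P.V) x.1 i := fun i => by
    rw [Finset.sum_add_distrib, sum_ite_eq_rightTerm, sum_ite_eq_leftTerm]
  -- the two telescoping sums
  have hT : ∑ i : Fin N, T / 2 *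
      (leftTerm (deriv (deriv P.V)) x.1 i - rightTerm (deriv (deriv P.V)) x.1 i) = 0 := by
    rw [← Finset.mul_sum, Finset.sum_sub_distrib, sum_leftTerm_eq_sum_rightTerm, sub_self, mul_zero]
  have hLR : ∑ i : Fin N, 1 / 2 *
      (leftTerm (deriv P.V) x.1 i * leftTerm (deriv P.V) x.1 i -
        rightTerm (deriv P.V) x.1 i * rightTerm (deriv P.V) x.1 i) = 0 := by
    simp_rw [leftTerm_mul_leftTerm, rightTerm_mul_rightTerm]
    rw [← Finset.mul_sum, Finset.sum_sub_distrib, sum_leftTerm_eq_sum_rightTerm, sub_self, mul_zero]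
  simp only [OscillatorChain.momentumLowering, partialQ_partialP_sum_bondCurrent P hV'd,
    partialP_sum_bondCurrent, Literature.Barriers.AtomisticToContinuum.partialQ_hamiltonian P hUd hVd,
    hRHS]
  rw [Finset.mul_sum]
  calc _ = ∑ i : Fin N,
        (-(1 / 2) * (deriv P.U (x.1 i) * (rightTerm (deriv P.V) x.1 i + leftTerm (deriv P.V) x.1 i)) +
          (T / 2 * (leftTerm (deriv (deriv P.V)) x.1 i - rightTerm (deriv (deriv P.V)) x.1 i) -
            1 / 2 * (leftTerm (deriv P.V) x.1 i * leftTerm (deriv P.V) x.1 i -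
              rightTerm (deriv P.V) x.1 i * rightTerm (deriv P.V) x.1 i))) :=
      Finset.sum_congr rfl fun i _ => by ring
    _ = _ := by
      rw [Finset.sum_add_distrib, Finset.sum_sub_distrib, hT, hLR, sub_zero, add_zero]

end Summit.AtomisticToContinuum.FouriersLaw.Theorems.LoweredCurrent
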